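import Literature.Computability.MetaComplexity.Oliveira2019.GapMrKtPMagnification
import Literature.Computability.Complexity.ToranWitness
import Literature.Computability.Complexity.CoinCounting
import HarnessLib

/-!
# `Gap-MrKtP` is non-degenerate: YES and NO instances at all large lengths (census rule F1, row R56)

Literature: I. C. Oliveira, *Randomness and intractability in Kolmogorov complexity*, ICALP 2019
(LIPIcs 132, Art. 32). Print treats non-degeneracy of `Gap-MrKtP[s₁, s₂]` as routine — p. 3,
L48–49: *"Again, it is not hard to solve this problem in randomized exponential time if there is a
certain (small) gap between s1(n) and s2(n)."*; p. 12, L41: *"rKt(w) ≥ log |w| since any machine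
that prints w runs in time at least |w|"* — and states no counting lemma; none is cited. This file
PROVES, for the tree rendering `Oliveira2019.rKt` / `Oliveira2019.gapMrKtP` of
`GapMrKtPMagnification.lean` (randomized programs over a reference `UniversalMachine`, coins read
as the program's input, free coin count), that the promise problems of row R56 —
`gapMrKtP U ⌊n^β⌋ ⌊n^β + d·log₂ n⌋` (Thm. 23, threshold side) and `gapMrKtP U ⌊n^{1/q}⌋ ⌊n/2⌋`
(Thm. 3 (ii) / Thm. 22, known side) — are NON-DEGENERATE: both promise sides are inhabited at every
large length. Nothing here is a cited fact; everything is [folklore] counting and simulation.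

## Main statements (all proved)

* `rKt_replicate_false_le`: for every `U` there are a program `e` and a constant `D` with
  `rKt_U(0ⁿ) ≤ |e| + D·(⌊log₂ n⌋ + 1)` for all `n` (simulate the one-state transducer `r ↦ 0^{|r|}`,
  the tree's `ToranCH.zeroT` of `Complexity/ToranWitness.lean`, through `UniversalMachine.sim`; the
  run succeeds on EVERY coin string, probability `1`).
* `eventually_replicate_false_mem_yes`: `∀ γ > 0`, eventually `0ⁿ ∈ YES(gapMrKtP U ⌊n^γ⌋ s₂)`.
* `outProb_output_unique`: for a fixed description `e` and coin count `m`, at most ONE string has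
  output probability `> 1/2` (over all budgets; from `run_mono` and additivity of the uniform
  measure) — the analogue of "a program prints at most one string".
* `ncard_setOf_rKt_le`: if `U` is input-bounded with constant `k` (`|prog| ≤ k·t` for halting runs)
  then `#{w | rKt_U(w) ≤ K} ≤ (K+1)·(k+1)·2^K` (a witness `(e, t, m)` has `|e| = j ≤ K`,
  `t ≤ 2^{K−j}`, `m ≤ k·t`, and `(e, m)` determines `w`).
* `exists_mem_gapMrKtP_no`, `eventually_exists_mem_no_half`, `eventually_exists_mem_no_powLog`:
  for input-bounded `U`, eventually some string of length `n` is a NO instance for the NO thresholds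
  `⌊n/2⌋` and `⌊n^β + d·log₂ n⌋` (`β < 1`).
* `gapMrKtP_thm23_nondegenerate`, `gapMrKtP_thm3_nondegenerate`: the two parameterisations of row
  R56, both sides inhabited eventually.

The coin count being free information to the program is paid for by the budget: an input-bounded
machine needs `t ≥ m/k` steps to accept `m` coins, so `⌈log₂ t⌉ ≥ log₂ m − log₂ k` — which is why the
count is `(K+1)(k+1)2^K` and not `2^{K+1}` as for `Kt` (`UniversalMachine.ncard_setOf_levinKt_lt`).
-/

namespace Literature.Computability.MetaComplexity.Oliveira2019

open Filter Topology Asymptotics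
open _root_.Computability
open Literature.Computability.Complexity Literature.Computability.MetaComplexity
open UniversalMachine OliveiraPichSanthanam2019

/-! ### Uniform-probability helpers (local; the basic API of `Randomized.lean` has no monotonicity) -/

/-- Monotonicity of `uniformProb` under inclusion. [folklore] -/
private theorem uniformProb_mono_subset {m : ℕ} {E E' : Set (List Bool)} (h : E ⊆ E') :
    uniformProb m E ≤ uniformProb m E' := by
  classical
  unfold uniformProb
  refine div_le_div_of_nonneg_right ?_ (by positivity)
  exact_mod_cast Finset.card_le_card fun r hr => by
    simp only [Finset.mem_filter, Finset.mem_univ, true_and] at hr ⊢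
    exact h hr

/-- An event containing every string of length `m` has probability `1`. [folklore] -/
theorem uniformProb_eq_one_of_forall {m : ℕ} {E : Set (List Bool)}
    (h : ∀ r : List Bool, r.length = m → r ∈ E) : uniformProb m E = 1 := by
  classical
  unfold uniformProb
  rw [Finset.filter_true_of_mem (fun (r : List.Vector Bool m) _ => h r.toList r.toList_length)]
  simp [card_vector]

/-- An event of positive probability contains a string of length `m`. [folklore] -/
theorem exists_mem_of_uniformProb_pos {m : ℕ} {E : Set (List Bool)} (h : 0 < uniformProb m E) :
    ∃ r : List Bool, r.length = m ∧ r ∈ E := by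
  classical
  by_contra hcon
  push Not at hcon
  unfold uniformProb at h
  rw [Finset.filter_false_of_mem (fun (r : List.Vector Bool m) _ => hcon r.toList r.toList_length)]
    at h
  simp at h

/-! ### YES side: `0ⁿ` has randomized Levin complexity `O(log n)` -/

/-- A TM2 machine printing `0^{|r|}` on input `r` in linear time. [folklore] -/
theorem exists_zero_machine : ∃ (M : Turing.TM2ComputableAux Bool Bool) (a : ℕ),
    ∀ r : List Bool, M.OutputsWithin r (List.replicate r.length false) (a * r.length + 3) := by
  obtain ⟨M, hM⟩ := ToranCH.zeroT.timeComputable_eval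
  refine ⟨M, ToranCH.zeroT.maxEmit + 1, fun r => ?_⟩
  have h := hM r
  simpa [ToranCH.zeroT_eval] using h

/-- If the run on EVERY coin string of length `m` prints `w`, the output probability is `1`.
[folklore] -/
theorem outProb_eq_one_of_forall {U : UniversalMachine} {e w : List Bool} {m t : ℕ}
    (h : ∀ r : List Bool, r.length = m → U.run (boolPair e r) t = some w) :
    outProb U e m t w = 1 :=
  uniformProb_eq_one_of_forall h

/-- A polynomial of a linear function is bounded by a power of two with exponent linear in
`⌊log₂ n⌋ + 1`. [folklore] -/
theorem exists_eval_linear_le_two_pow (p : Polynomial ℕ) (a : ℕ) :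
    ∃ D : ℕ, ∀ n : ℕ, p.eval (a * n + 3) ≤ 2 ^ (D * (Nat.log 2 n + 1)) := by
  obtain ⟨c, k, hck⟩ := exists_eval_le_mul_pow_add p
  -- `E` absorbs the constant `c (a+3)^k + c`
  refine ⟨Nat.clog 2 (c * (a + 3) ^ k + c) + k, fun n => ?_⟩
  set L := Nat.log 2 n with hL
  have hn : n + 1 ≤ 2 ^ (L + 1) := Nat.lt_pow_succ_log_self one_lt_two n
  have h1 : a * n + 3 ≤ (a + 3) * 2 ^ (L + 1) := by
    have : a * n + 3 ≤ (a + 3) * (n + 1) := by nlinarith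
    exact this.trans (Nat.mul_le_mul_left _ hn)
  have h2 : (a * n + 3) ^ k ≤ (a + 3) ^ k * 2 ^ (k * (L + 1)) := by
    calc (a * n + 3) ^ k ≤ ((a + 3) * 2 ^ (L + 1)) ^ k := Nat.pow_le_pow_left h1 k
      _ = (a + 3) ^ k * 2 ^ (k * (L + 1)) := by rw [mul_pow, ← pow_mul, mul_comm (L + 1) k]
  have hC : c * (a + 3) ^ k + c ≤ 2 ^ Nat.clog 2 (c * (a + 3) ^ k + c) := Nat.le_pow_clog one_lt_two _
  have h1le : 1 ≤ 2 ^ (k * (L + 1)) := Nat.one_le_two_pow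
  calc p.eval (a * n + 3) ≤ c * (a * n + 3) ^ k + c := hck _
    _ ≤ c * ((a + 3) ^ k * 2 ^ (k * (L + 1))) + c * 2 ^ (k * (L + 1)) := by
        have := Nat.mul_le_mul_left c h2
        nlinarith
    _ = (c * (a + 3) ^ k + c) * 2 ^ (k * (L + 1)) := by ring
    _ ≤ 2 ^ Nat.clog 2 (c * (a + 3) ^ k + c) * 2 ^ (k * (L + 1)) := Nat.mul_le_mul_right _ hC
    _ = 2 ^ (Nat.clog 2 (c * (a + 3) ^ k + c) + k * (L + 1)) := by rw [← pow_add]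
    _ ≤ 2 ^ ((Nat.clog 2 (c * (a + 3) ^ k + c) + k) * (L + 1)) :=
        Nat.pow_le_pow_right (by norm_num) (by nlinarith)

/-- **`rKt(0ⁿ) = O(log n)`**: for every reference machine there are a (fixed) randomized program `e`
— the code of the transducer `r ↦ 0^{|r|}` (`ToranCH.zeroT`), which ignores the values of its `n`
coins — and a
constant `D` with `rKt_U(0ⁿ) ≤ |e| + D·(⌊log₂ n⌋ + 1)` for all `n`. (simulation, `UniversalMachine.sim`)
[folklore] -/
theorem rKt_replicate_false_le (U : UniversalMachine) : ∃ (e : List Bool) (D : ℕ), ∀ n : ℕ,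
    rKt U (List.replicate n false) ≤ ((e.length + D * (Nat.log 2 n + 1) : ℕ) : ℕ∞) := by
  obtain ⟨M, a, hM⟩ := exists_zero_machine
  obtain ⟨e, p, he⟩ := U.sim M
  obtain ⟨D, hD⟩ := exists_eval_linear_le_two_pow p a
  refine ⟨e, D, fun n => ?_⟩
  have hrun : ∀ r : List Bool, r.length = n →
      U.run (boolPair e r) (p.eval (a * n + 3)) = some (List.replicate n false) := by
    intro r hr
    have := he r (List.replicate r.length false) (a * r.length + 3) (hM r)
    rwa [hr] at this
  have hprob : (2 / 3 : ℝ) ≤ outProb U e n (p.eval (a * n + 3)) (List.replicate n false) := by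
    rw [outProb_eq_one_of_forall hrun]; norm_num
  have h1 : rKt U (List.replicate n false) ≤ ((e.length + Nat.clog 2 (p.eval (a * n + 3)) : ℕ) : ℕ∞) :=
    rKtAt_le_of_outProb hprob
  refine h1.trans ?_
  have hclog : Nat.clog 2 (p.eval (a * n + 3)) ≤ D * (Nat.log 2 n + 1) :=
    (Nat.clog_le_iff_le_pow one_lt_two).2 (hD n)
  exact_mod_cast Nat.add_le_add_left hclog _

/-- A constant plus a multiple of `log₂ n` is eventually below `n^γ` (`γ > 0`). [folklore] -/
theorem eventually_const_add_mul_logb_le_rpow (A B : ℝ) {γ : ℝ} (hγ : 0 < γ) :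
    ∀ᶠ n : ℕ in atTop, A + B * Real.logb 2 n ≤ (n : ℝ) ^ γ := by
  have hl2 : 0 < Real.log 2 := Real.log_pos one_lt_two
  -- (1) |B| * logb 2 n ≤ n^γ / 2 eventually
  have hlog : ∀ᶠ n : ℕ in atTop, |B| * Real.logb 2 n ≤ (n : ℝ) ^ γ / 2 := by
    have hc : (0 : ℝ) < Real.log 2 / (2 * (|B| + 1)) := by positivity
    have hbd := (isLittleO_log_rpow_atTop hγ).bound hc
    have hbd' : ∀ᶠ n : ℕ in atTop, ‖Real.log n‖ ≤ Real.log 2 / (2 * (|B| + 1)) * ‖(n : ℝ) ^ γ‖ :=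
      tendsto_natCast_atTop_atTop.eventually hbd
    filter_upwards [hbd'] with n hn
    have hn0 : (0 : ℝ) ≤ n := Nat.cast_nonneg n
    rw [Real.norm_eq_abs, Real.norm_eq_abs, abs_of_nonneg (Real.rpow_nonneg hn0 γ)] at hn
    have hlogle : Real.log n ≤ Real.log 2 / (2 * (|B| + 1)) * (n : ℝ) ^ γ := (le_abs_self _).trans hn
    have hB0 : 0 ≤ |B| := abs_nonneg B
    have hB1 : |B| ≤ |B| + 1 := by linarith
    rw [Real.logb, mul_div_assoc', div_le_iff₀ hl2]
    have hr0 : 0 ≤ Real.log 2 / (2 * (|B| + 1)) * (n : ℝ) ^ γ := by positivity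
    calc |B| * Real.log n ≤ (|B| + 1) * (Real.log 2 / (2 * (|B| + 1)) * (n : ℝ) ^ γ) := by
          nlinarith [hlogle, hr0]
      _ = (n : ℝ) ^ γ / 2 * Real.log 2 := by field_simp
  -- (2) A ≤ n^γ / 2 eventually
  have hconst : ∀ᶠ n : ℕ in atTop, A ≤ (n : ℝ) ^ γ / 2 := by
    have ht : Tendsto (fun n : ℕ => (n : ℝ) ^ γ) atTop atTop :=
      (tendsto_rpow_atTop hγ).comp tendsto_natCast_atTop_atTop
    filter_upwards [ht.eventually (eventually_ge_atTop (2 * A))] with n hn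
    have : 2 * A ≤ (n : ℝ) ^ γ := hn
    linarith
  filter_upwards [hlog, hconst, eventually_ge_atTop 1] with n h1 h2 hn1
  have hlb : 0 ≤ Real.logb 2 n :=
    Real.logb_nonneg one_lt_two (by exact_mod_cast hn1)
  have : B * Real.logb 2 n ≤ |B| * Real.logb 2 n :=
    mul_le_mul_of_nonneg_right (le_abs_self B) hlb
  linarith

/-- **YES side inhabited eventually**: for every `γ > 0` and every NO threshold `s₂`, the string `0ⁿ`
is a YES instance of `Gap-MrKtP[⌊n^γ⌋, s₂]` for all large `n`. [folklore] -/
theorem eventually_replicate_false_mem_yes (U : UniversalMachine) {γ : ℝ} (hγ : 0 < γ)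
    (s₂ : ℕ → ℕ) : ∀ᶠ n : ℕ in atTop,
      List.replicate n false ∈ (gapMrKtP U (powThreshold γ) s₂).yes := by
  obtain ⟨e, D, hD⟩ := rKt_replicate_false_le U
  filter_upwards [eventually_const_add_mul_logb_le_rpow (e.length + D) D hγ, eventually_ge_atTop 1]
    with n hn hn1
  rw [mem_gapMrKtP_yes_iff, List.length_replicate]
  refine (hD n).trans ?_
  have hlog : (Nat.log 2 n : ℝ) ≤ Real.logb 2 n := Real.natLog_le_logb n 2
  have hreal : ((e.length + D * (Nat.log 2 n + 1) : ℕ) : ℝ) ≤ (n : ℝ) ^ γ := by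
    push_cast
    have hD0 : (0 : ℝ) ≤ D := Nat.cast_nonneg D
    nlinarith [hn, hlog, hD0]
  have hfloor : e.length + D * (Nat.log 2 n + 1) ≤ powThreshold γ n := by
    unfold powThreshold
    exact Nat.le_floor hreal
  exact_mod_cast hfloor

/-! ### NO side: counting descriptions `(e, m)` -/

/-- **A description prints at most one string**: for a fixed randomized program `e` and coin count
`m`, two strings with output probability `> 1/2` (at any two budgets) coincide — the larger budget
preserves the first event (`run_mono`), and two disjoint events cannot both exceed `1/2`. [folklore] -/
theorem outProb_output_unique {U : UniversalMachine} {e : List Bool} {m t₁ t₂ : ℕ} {w₁ w₂ : List Bool}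
    (h₁ : (1 / 2 : ℝ) < outProb U e m t₁ w₁) (h₂ : (1 / 2 : ℝ) < outProb U e m t₂ w₂) : w₁ = w₂ := by
  by_contra hne
  wlog ht : t₁ ≤ t₂ generalizing t₁ t₂ w₁ w₂
  · exact this h₂ h₁ (Ne.symm hne) (le_of_not_ge ht)
  have hsub : {r : List Bool | U.run (boolPair e r) t₁ = some w₁} ⊆
      {r : List Bool | U.run (boolPair e r) t₂ = some w₁} := fun r hr => U.run_mono ht hr
  have hdisj : {r : List Bool | U.run (boolPair e r) t₂ = some w₂} ⊆
      {r : List Bool | U.run (boolPair e r) t₂ = some w₁}ᶜ := by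
    intro r hr₂ hr₁
    exact hne (Option.some.inj (hr₁.symm.trans hr₂))
  have hA : (1 / 2 : ℝ) < uniformProb m {r : List Bool | U.run (boolPair e r) t₂ = some w₁} :=
    h₁.trans_le (uniformProb_mono_subset hsub)
  have hB := uniformProb_mono_subset (m := m) hdisj
  rw [uniformProb_compl] at hB
  have h₂' : (1 / 2 : ℝ) < uniformProb m {r : List Bool | U.run (boolPair e r) t₂ = some w₂} := h₂
  linarith

/-- Unfolding `rKt(w) ≤ K` for an input-bounded machine: a witness `(e, t, m)` with `|e| + ⌈log₂ t⌉ ≤ K`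
and `m ≤ k·t ≤ k·2^{K − |e|}`. [folklore] -/
theorem exists_description_of_rKt_le {U : UniversalMachine} {k : ℕ}
    (hk : ∀ (prog : List Bool) (t : ℕ) (y : List Bool), U.run prog t = some y → prog.length ≤ k * t)
    {w : List Bool} {K : ℕ} (h : rKt U w ≤ K) :
    ∃ (e : List Bool) (t m : ℕ), (2 / 3 : ℝ) ≤ outProb U e m t w ∧ e.length ≤ K ∧
      m ≤ k * 2 ^ (K - e.length) := by
  have hlt : rKt U w < ((K + 1 : ℕ) : ℕ∞) := lt_of_le_of_lt h (by exact_mod_cast Nat.lt_succ_self K)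
  obtain ⟨e, t, m, hprob, hcost⟩ := exists_outProb_of_rKtAt_lt hlt
  have hcost' : e.length + Nat.clog 2 t ≤ K := by
    have : e.length + Nat.clog 2 t < K + 1 := by exact_mod_cast hcost
    omega
  refine ⟨e, t, m, hprob, by omega, ?_⟩
  -- the event is nonempty, so some coin string of length `m` is accepted within budget `t`
  obtain ⟨r, hr, hrun⟩ := exists_mem_of_uniformProb_pos (lt_of_lt_of_le (by norm_num) hprob)
  have hlen := hk _ _ _ hrun
  rw [length_boolPair, hr] at hlen
  have ht : t ≤ 2 ^ (K - e.length) :=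
    (Nat.le_pow_clog one_lt_two t).trans (Nat.pow_le_pow_right (by norm_num) (by omega))
  calc m ≤ k * t := by nlinarith
    _ ≤ k * 2 ^ (K - e.length) := Nat.mul_le_mul_left k ht

/-- The strings with `rKt ≤ K` inject into the descriptions `(e, m)` with `|e| = j ≤ K` and
`m ≤ k·2^{K−j}`. [folklore] -/
theorem exists_injective_of_rKt_le {U : UniversalMachine} {k : ℕ}
    (hk : ∀ (prog : List Bool) (t : ℕ) (y : List Bool), U.run prog t = some y → prog.length ≤ k * t)
    (K : ℕ) :
    ∃ g : {w | rKt U w ≤ K} → (Σ j : Fin (K + 1), List.Vector Bool j × Fin (k * 2 ^ (K - j) + 1)),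
      Function.Injective g := by
  set S : Set (List Bool) := {w | rKt U w ≤ K}
  have hS : ∀ w : S, ∃ e : List Bool, ∃ m : ℕ, (∃ t, (2 / 3 : ℝ) ≤ outProb U e m t w.1) ∧
      e.length < K + 1 ∧ m < k * 2 ^ (K - e.length) + 1 := fun w => by
    obtain ⟨e, t, m, hprob, he, hm⟩ := exists_description_of_rKt_le hk w.2
    exact ⟨e, m, ⟨t, hprob⟩, by omega, by omega⟩
  choose f g hprob hfl hgl using hS
  refine ⟨fun w => ⟨⟨(f w).length, hfl w⟩, (⟨f w, rfl⟩, ⟨g w, hgl w⟩)⟩, ?_⟩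
  intro w w' h
  have hf : f w = f w' := by
    have := congr_arg (fun s : Σ j : Fin (K + 1), List.Vector Bool j × Fin (k * 2 ^ (K - j) + 1) =>
      s.2.1.toList) h
    exact this
  have hg : g w = g w' := by
    have := congr_arg (fun s : Σ j : Fin (K + 1), List.Vector Bool j × Fin (k * 2 ^ (K - j) + 1) =>
      (s.2.2 : ℕ)) h
    exact this
  obtain ⟨t, ht⟩ := hprob w
  obtain ⟨t', ht'⟩ := hprob w'
  rw [hf, hg] at ht
  have h23 : (1 / 2 : ℝ) < 2 / 3 := by norm_num
  exact Subtype.ext (outProb_output_unique (h23.trans_le ht) (h23.trans_le ht'))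

/-- The set of strings with `rKt ≤ K` is finite (input-bounded machine). [folklore] -/
theorem finite_setOf_rKt_le {U : UniversalMachine} {k : ℕ}
    (hk : ∀ (prog : List Bool) (t : ℕ) (y : List Bool), U.run prog t = some y → prog.length ≤ k * t)
    (K : ℕ) : {w | rKt U w ≤ K}.Finite := by
  obtain ⟨g, hg⟩ := exists_injective_of_rKt_le hk K
  haveI := Finite.of_injective g hg
  exact Set.toFinite _

/-- **Counting**: for an input-bounded machine with constant `k`, at most `(K+1)·(k+1)·2^K` strings
have `rKt ≤ K`. [folklore] -/
theorem ncard_setOf_rKt_le {U : UniversalMachine} {k : ℕ}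
    (hk : ∀ (prog : List Bool) (t : ℕ) (y : List Bool), U.run prog t = some y → prog.length ≤ k * t)
    (K : ℕ) : {w | rKt U w ≤ K}.ncard ≤ (K + 1) * ((k + 1) * 2 ^ K) := by
  obtain ⟨g, hg⟩ := exists_injective_of_rKt_le hk K
  have hterm : ∀ j ∈ Finset.range (K + 1), 2 ^ j * (k * 2 ^ (K - j) + 1) ≤ (k + 1) * 2 ^ K := by
    intro j hj
    have hjK : j ≤ K := Nat.lt_succ_iff.mp (Finset.mem_range.mp hj)
    have hsplit : 2 ^ j * 2 ^ (K - j) = 2 ^ K := by rw [← pow_add, Nat.add_sub_cancel' hjK]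
    have hjle : 2 ^ j ≤ 2 ^ K := Nat.pow_le_pow_right (by norm_num) hjK
    calc 2 ^ j * (k * 2 ^ (K - j) + 1) = k * (2 ^ j * 2 ^ (K - j)) + 2 ^ j := by ring
      _ = k * 2 ^ K + 2 ^ j := by rw [hsplit]
      _ ≤ k * 2 ^ K + 2 ^ K := Nat.add_le_add_left hjle _
      _ = (k + 1) * 2 ^ K := by ring
  calc {w | rKt U w ≤ K}.ncard = Nat.card {w | rKt U w ≤ K} := (Nat.card_coe_set_eq _).symm
    _ ≤ Nat.card (Σ j : Fin (K + 1), List.Vector Bool j × Fin (k * 2 ^ (K - j) + 1)) :=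
        Nat.card_le_card_of_injective g hg
    _ = ∑ j ∈ Finset.range (K + 1), 2 ^ j * (k * 2 ^ (K - j) + 1) := by
        rw [Nat.card_eq_fintype_card, Fintype.card_sigma]
        simp only [Fintype.card_prod, card_vector, Fintype.card_bool, Fintype.card_fin]
        exact Fin.sum_univ_eq_sum_range (fun j => 2 ^ j * (k * 2 ^ (K - j) + 1)) (K + 1)
    _ ≤ ∑ _j ∈ Finset.range (K + 1), (k + 1) * 2 ^ K := Finset.sum_le_sum hterm
    _ = (K + 1) * ((k + 1) * 2 ^ K) := by simp

/-- There are exactly `2^n` strings of length `n`. [folklore] -/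
private theorem ncard_setOf_length_eq_two_pow (n : ℕ) :
    ({x : List Bool | x.length = n}).ncard = 2 ^ n := by
  rw [← Nat.card_coe_set_eq]
  show Nat.card (List.Vector Bool n) = 2 ^ n
  rw [Nat.card_eq_fintype_card, card_vector, Fintype.card_bool]

/-- **NO side inhabited** whenever the description count is below `2^n`: if
`(s₂(n)+1)·(k+1)·2^{s₂(n)} < 2^n` then some string of length `n` has `rKt > s₂(n)`. [folklore] -/
theorem exists_mem_gapMrKtP_no {U : UniversalMachine} {k : ℕ}
    (hk : ∀ (prog : List Bool) (t : ℕ) (y : List Bool), U.run prog t = some y → prog.length ≤ k * t)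
    {s₁ s₂ : ℕ → ℕ} {n : ℕ} (h : (s₂ n + 1) * ((k + 1) * 2 ^ s₂ n) < 2 ^ n) :
    ∃ w : List Bool, w.length = n ∧ w ∈ (gapMrKtP U s₁ s₂).no := by
  by_contra hcon
  push Not at hcon
  have hAB : {x : List Bool | x.length = n} ⊆ {w | rKt U w ≤ s₂ n} := by
    intro x hx
    have hx' : x.length = n := hx
    have h1 := hcon x hx'
    rw [mem_gapMrKtP_no_iff, not_lt, hx'] at h1
    exact h1
  have h1 := Set.ncard_le_ncard hAB (finite_setOf_rKt_le hk (s₂ n))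
  have h2 := ncard_setOf_rKt_le hk (s₂ n)
  rw [ncard_setOf_length_eq_two_pow] at h1
  omega

/-- `(j+1)² < 2^j` for `j ≥ 7`. [folklore] -/
private theorem succ_sq_lt_two_pow {j : ℕ} (hj : 7 ≤ j) : (j + 1) ^ 2 < 2 ^ j := by
  induction j, hj using Nat.le_induction with
  | base => norm_num
  | succ j hj ih =>
    have h2 : (j + 1 + 1) ^ 2 ≤ 2 * (j + 1) ^ 2 := by nlinarith
    calc (j + 1 + 1) ^ 2 ≤ 2 * (j + 1) ^ 2 := h2
      _ < 2 * 2 ^ j := by omega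
      _ = 2 ^ (j + 1) := by ring

/-- The description count at the NO threshold `⌊n/2⌋` is below `2^n` once `n ≥ 2(k+7)`. [folklore] -/
theorem half_count_lt_two_pow (k : ℕ) {n : ℕ} (hn : 2 * (k + 7) ≤ n) :
    (n / 2 + 1) * ((k + 1) * 2 ^ (n / 2)) < 2 ^ n := by
  set j := n / 2 with hj
  have hkj : k + 7 ≤ j := by omega
  have hsq := succ_sq_lt_two_pow (show 7 ≤ j by omega)
  have h1 : (j + 1) * (k + 1) < 2 ^ j := by
    have : (j + 1) * (k + 1) ≤ (j + 1) ^ 2 := by nlinarith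
    exact lt_of_le_of_lt this hsq
  have h2 : 2 ^ j * 2 ^ j ≤ 2 ^ n := by
    rw [← pow_add]
    exact Nat.pow_le_pow_right (by norm_num) (by omega)
  calc (j + 1) * ((k + 1) * 2 ^ j) = (j + 1) * (k + 1) * 2 ^ j := by ring
    _ < 2 ^ j * 2 ^ j := Nat.mul_lt_mul_of_pos_right h1 (by positivity)
    _ ≤ 2 ^ n := h2

/-- **NO side of Theorem 3 (ii)'s problem inhabited eventually**: for an input-bounded `U`, some string
of each large length `n` has `rKt > ⌊n/2⌋`. [folklore] -/
theorem eventually_exists_mem_no_half {U : UniversalMachine} (hU : InputBounded U) (s₁ : ℕ → ℕ) :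
    ∀ᶠ n : ℕ in atTop, ∃ w : List Bool, w.length = n ∧ w ∈ (gapMrKtP U s₁ (fun n => n / 2)).no := by
  obtain ⟨k, hk⟩ := hU
  filter_upwards [eventually_ge_atTop (2 * (k + 7))] with n hn
  exact exists_mem_gapMrKtP_no hk (half_count_lt_two_pow k hn)

/-- **NO side of Theorem 23's problem inhabited eventually**: for an input-bounded `U` and `β < 1`,
some string of each large length `n` has `rKt > ⌊n^β + d·log₂ n⌋` (that threshold is eventually
`≤ ⌊n/2⌋`, `eventually_powLogThreshold_le_half`). [folklore] -/
theorem eventually_exists_mem_no_powLog {U : UniversalMachine} (hU : InputBounded U) (s₁ : ℕ → ℕ)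
    {β : ℝ} (hβ : β < 1) (d : ℕ) :
    ∀ᶠ n : ℕ in atTop, ∃ w : List Bool, w.length = n ∧
      w ∈ (gapMrKtP U s₁ (powLogThreshold β d)).no := by
  filter_upwards [eventually_exists_mem_no_half hU s₁, eventually_powLogThreshold_le_half hβ d]
    with n hw hle
  obtain ⟨w, hw, hno⟩ := hw
  refine ⟨w, hw, ?_⟩
  rw [mem_gapMrKtP_no_iff] at hno ⊢
  rw [hw] at hno ⊢
  exact lt_of_le_of_lt (by exact_mod_cast hle) hno

/-! ### Row R56: both parameterisations are non-degenerate -/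

/-- **Theorem 23's promise problem is non-degenerate** (census rule F1 for the threshold side of row
R56): for input-bounded `U`, `0 < β < 1` and any `d`, at every large length both the YES side
(`rKt ≤ ⌊n^β⌋`, witnessed by `0ⁿ`) and the NO side (`rKt > ⌊n^β + d·log₂ n⌋`) of
`gapMrKtP U ⌊n^β⌋ ⌊n^β + d·log₂ n⌋` are inhabited. [folklore] -/
theorem gapMrKtP_thm23_nondegenerate {U : UniversalMachine} (hU : InputBounded U) {β : ℝ}
    (hβ0 : 0 < β) (hβ1 : β < 1) (d : ℕ) :
    ∀ᶠ n : ℕ in atTop,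
      (∃ w : List Bool, w.length = n ∧ w ∈ (gapMrKtP U (powThreshold β) (powLogThreshold β d)).yes) ∧
      (∃ w : List Bool, w.length = n ∧ w ∈ (gapMrKtP U (powThreshold β) (powLogThreshold β d)).no) := by
  filter_upwards [eventually_replicate_false_mem_yes U hβ0 (powLogThreshold β d),
    eventually_exists_mem_no_powLog hU (powThreshold β) hβ1 d] with n hyes hno
  exact ⟨⟨_, List.length_replicate, hyes⟩, hno⟩

/-- **Theorem 3 (ii)'s promise problem is non-degenerate** (census rule F1 for the known side of row
R56): for input-bounded `U` and `q ≥ 1`, at every large length both sides of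
`gapMrKtP U ⌊n^{1/q}⌋ ⌊n/2⌋` are inhabited. [folklore] -/
theorem gapMrKtP_thm3_nondegenerate {U : UniversalMachine} (hU : InputBounded U) {q : ℕ} (hq : 1 ≤ q) :
    ∀ᶠ n : ℕ in atTop,
      (∃ w : List Bool, w.length = n ∧ w ∈ (gapMrKtP U (powThreshold (1 / q)) (fun n => n / 2)).yes) ∧
      (∃ w : List Bool, w.length = n ∧ w ∈ (gapMrKtP U (powThreshold (1 / q)) (fun n => n / 2)).no) := by
  have hγ : (0 : ℝ) < 1 / q := by
    have : (0 : ℝ) < q := by exact_mod_cast hq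
    positivity
  filter_upwards [eventually_replicate_false_mem_yes U hγ (fun n => n / 2),
    eventually_exists_mem_no_half hU (powThreshold (1 / q))] with n hyes hno
  exact ⟨⟨_, List.length_replicate, hyes⟩, hno⟩

end Literature.Computability.MetaComplexity.Oliveira2019
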